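import Summits.Schanuel.Schanuel.Theorems.RootDecomp1KSectorSubspace02

/-!
# RootDecomp1KSectorSubspace — lens 1, generation 70, NODE 30 «THE (4,2)-SECTOR BOX WITH SIMPLE EDGE ROOTS IS SUBSPACE» (×0-AS-RECORD, CONDITIONAL LANE — PRICE L3112, RULING L3115 (4); CLAIM L3110, NODE L3125, VERDICT L3131): for the (4,2)-sector box `boxP q` = (Y⁴ + δY³ + ζ₂Y² + ζ₁Y + ζ₀) + x·(αY² + βY + ε) + γ·x² with γ ODD and the edge quartic W⁴ + αW² + γ SEPARABLE, WINDOW LEVEL-FINITENESS and hence `LevelFinite` / `ThinFibreAt m₀` for every m₀ MODULO the route's existing binder `PadicSubspace` (hypothesis `hS`, never an axiom): `window_levels_finite`, `levelFinite_box_of_padicSubspace`, `thinFibreAt_box_of_padicSubspace`; node 11's second-order Subspace lever (tree `Lform` / `Mform` / `nearest_root` / `isAlgebraic_corr` BY NAME) transplanted to the (∞,∞) sector and closed by `transcendental_liouvilleNumber`; (H7) the GENERIC member (separable Δ_x) is node 23's — `thinFibreAt_box_of_separable_pDisc` hypothesis-free, `domHyper_box_iff`, `thinFibreAt_box_dichotomy`;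 consistency probe ρ1 (`thinFibreAt_rho1_of_padicSubspace`, unconditional by node 28); specimen M30 = (Y⁴ − Y³ − 6Y² + 2Y + 15) + x·(4Y² + Y − 27) + 11x² (singular at (1,1), ¬DomHyper, not split in the given coordinates, split after translation): `thinFibreAt_m30_of_padicSubspace` — continuation (RootDecomp1KSectorSubspace03): # §6  Assembly: WINDOW LEVEL-FINITENESS of the box, modulo `PadicSubspace` — 11 declarations `bev_boxP_liouville_ne_zero` … `thinFibreAt_box_of_padicSubspace'`

(lens-1 g70 NODE 30 «THE (4,2)-SECTOR BOX WITH SIMPLE EDGE ROOTS IS SUBSPACE» L3125: HOME kernel K = HOME/decomp-schanuel-lens-1/g70/lean/SectorSubspace.lean sha256 30de2f8e…, 1334 l, 87 decls (78 theorems + 8 defs + 1 structure `SectorBox`), ONE namespace `Summit.Schanuel.Schanuel.Theorems.RootDecomp1KSectorSubspace`, imports the tree port …RootDecomp1KExhibitDescent03 ONLY (node 29's record port; `PadicSubspace` / `Lform` / `Mform` / `nearest_root` / `isAlgebraic_corr` (SubspaceBranch), `rho1` (SectorTheorem), `pDisc` / `DomHyper` / `thinFibreAt_dom2` (HyperellipticSiegel),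 `thinFibreAt_of_levelFinite`, `tendsto_partialSum_two` BY TREE NAME); no private / instance / set_option / notation / sorry / new axiom; the binder `PadicSubspace` appears ONLY as the hypothesis `hS` of the `…_of_padicSubspace` heads; lens farm rc 0 · 0 errors · 0 sorries · 99 dupNamespace, `--axioms` standard on 13 heads, Probe g70/out/Probe.lean e9bf9f63… rc 0 (rfl pins @PadicSubspace = tree, @rho1 = tree, @pDisc / @DomHyper / @LevelFinite = tree), CONTROL ProbeCtrl ec7805c4… rc 1 as designed, memo g70/NODE-g70.md 51b8502c…, SHA256SUMS 23/23; CLAIM L3110 (ASK-FIRST; conditional class theorem, no new binder, no exhibit); crit g12 PRICE 30 L3112: ×0-AS-RECORD, PORT WELCOME (conditional lane, like W4Dossier01 — K-R56 (ii)/(iii), the W4 precedent RULING L2988, K-R58 (iii): the binder PROVED is the one payable head), CHECKLIST K-g70 (H1)–(H6) + (S), W-30-1; writer g36 NOTE 4 L3113 (arithmetic pre-check 11/11 on 122 472 cleared quartics); census INSTRUMENT NOTE 48 L3114 (CE-25-1: the residue exhibits of record were DomHyper) and crit RULING L3115 ((3) ERRATUM E7 FIXED; (4) PRICE 30 REFINED: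 the box ∩ {{Δ_x separable}} is ALREADY DECIDED UNCONDITIONALLY by node 23's `thinFibreAt_dom2`, node 30's proper conditional reach = the SINGULAR members (α)/(β), CHECKLIST += (H7)); writer NOTE 5 L3123 (exhaustive box census 15 309: separable 14 498 / inseparable 811); census LIVENESS-v43 key box30 (rows 63 rho1 / 70 ρ1′ / 73 specimen); crit g13 VERDICT 30 L3131: «×0-AS-RECORD — BOOKED as priced (PRICE L3112, RULING L3115 (4)); CHECKLIST K-g70 (H1)–(H7) + (S) MET; NO objection to any kernel statement; three errata-lite in PROSE only (e30-2 lens, e30-3 writer, CE-25-2 census), all on the abscissa convention — zero kernel and zero record consequence; decl census 90 = 81 theorems + 8 defs + 1 structure (the three @[simp] lemmas svec_zero/one/two counted); --axioms on 33 heads standard, PadicSubspace ONLY as the explicit binder hS; RECORD AT VERDICT 30: Dom(PadicSubspace) map entry := {node 11 SepTopAt classes, W4, node-30 box ∖ DomHyper}, the DomHyper part printed in the UNCONDITIONAL lane as node 23 (H7); open territory / exhibits VACANT / ledger / tally UNCHANGED; PORT GO (conditional lane, W4Dossier01 precedent; every …_of_padicSubspace head keeps (hS : PadicSubspace) explicit;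 statements byte-verbatim to K; e30-2 docstring clause at the census choice — carried VERBATIM here, e30-2 standing in the errata list)». PORT-SIDE MODIFIER (bounce p850098, dedup.landed): K l.607 abs_num_eq ≡ tree RootDecomp1EPointTransfer.abs_num_eq ⇒ PRIVATE in part 02 + a private copy in part 03 (one use each), statements / proofs = K. Port by census-1 gen 25 as `RootDecomp1KSectorSubspace01–05` (files ≤ 400 lines; `--supports stmt-Schanuel-33364`, the item stays OPEN; ×0 record port in the CONDITIONAL lane — every `…_of_padicSubspace` head carries the hypothesis `hS : PadicSubspace` explicitly (W4Dossier01 precedent); no credit anywhere; record effect at VERDICT 30 = the MAP entry Dom(PadicSubspace) ∪= node-30 box ∖ DomHyper, the DomHyper part in the unconditional lane (node 23)): 01 = K l.1–384 of the prepped source (opens # §0 / # §1) — 25 decls `norm_two_ss`, `norm_two_pow_ss`, `norm_intCast_le_one_ss`, …, `eventually_K₀_small_ss`; 02 = K l.385–691 of the prepped source (opens # §2 / # §3 / # §4 / # §5) — 16 decls `level_shape`, `level_padic`, `first_order`, …, `sector_arith`; 03 = K l.692–1012 of the prepped source (opens # §6) — 11 decls `bev_boxP_liouville_ne_zero`, `no_point_near`,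 `level_le_two_mul_pow`, …, `thinFibreAt_box_of_padicSubspace'`; 04 = K l.1013–1333 of the prepped source (opens # §7 / # §8 / # §9) — 37 decls `level_second_order`, `rho1Box`, `boxC_rho1Box`, …, `domHyper_box_iff`; 05 = K l.1334–1343 of the prepped source (inside # §9) — 1 decls `thinFibreAt_box_dichotomy`. 0 one-line docstrings synthesised for undocumented helper declarations (statements quoted); everything else = K VERBATIM (statements, names, proofs, K's module docstring kept in part 01 below this provenance block).)
-/

noncomputable section

namespace Summit.Schanuel.Schanuel.Theorems.RootDecomp1KSectorSubspace

open Polynomial LiouvilleNumber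
open scoped Nat
open Summit.Schanuel.Schanuel.Theorems.RootDecomp1KTwoBaseCell (psNumer partialSum_eq_psNumer_div coprime_psNumer)
open Summit.Schanuel.Schanuel.Theorems.RootDecomp1KRelLiouvilleCell (partialSum_two_strictMono)
open Summit.Schanuel.Schanuel.Theorems.RootDecomp1KDegreeLadder
open Summit.Schanuel.Schanuel.Theorems.RootDecomp1KXLinearCore
open Summit.Schanuel.Schanuel.Theorems.RootDecomp1KXLinear
open Summit.Schanuel.Schanuel.Theorems.RootDecomp1KXLinearII
open Summit.Schanuel.Schanuel.Theorems.RootDecomp1KXTop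
open Summit.Schanuel.Schanuel.Theorems.RootDecomp1KSubspaceBranch
open Summit.Schanuel.Schanuel.Theorems.RootDecomp1KDigitPincer (odd_psNumer_two)
open Summit.Schanuel.Schanuel.Theorems.RootDecomp1KSectorTheorem (rho1 tendsto_partialSum_two)
open Summit.Schanuel.Schanuel.Theorems.RootDecomp1KHyperellipticSiegel (pDisc DomHyper domHyper_xPolyP_iff thinFibreAt_dom2 levelFinite_dom2)
open Summit.Schanuel.Schanuel.Theorems.RootDecomp1KIntegrality (DomZero)
open Summit.Schanuel.Schanuel.Theorems.RootDecomp1KLevelFinite (LevelSet LevelFinite thinFibreAt_of_levelFinite)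
open Summit.Schanuel.Schanuel.Theorems.RootDecomp1KHeightGrading (BddLevelEmpty bddLevelEmpty_iff_levelFinite)

/-- **the box member does not vanish at `(ℓ₂, κ)`** for rational `κ`: `P(ℓ₂, κ) = A + B·ℓ₂ + γ·ℓ₂²` with
`A, B ∈ ℚ`, `γ ≠ 0`, and `ℓ₂` is transcendental (Mathlib `transcendental_liouvilleNumber`). -/
theorem bev_boxP_liouville_ne_zero (q : SectorBox) (hγ : q.γ ≠ 0) (κ : ℚ) :
    bev (boxP q) (liouvilleNumber 2) κ ≠ 0 := by
  intro h
  rw [bev_boxP] at h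
  set A : ℚ := κ ^ 4 + q.δ * κ ^ 3 + q.ζ₂ * κ ^ 2 + q.ζ₁ * κ + q.ζ₀ with hA
  set B : ℚ := q.α * κ ^ 2 + q.β * κ + q.ε with hB
  set Q : ℚ[X] := C (q.γ : ℚ) * X ^ 2 + C B * X + C A with hQ
  have hQ2 : Q.coeff 2 = (q.γ : ℚ) := by
    rw [hQ]
    simp
  have hQ0 : Q ≠ 0 := by
    intro h0
    rw [h0, coeff_zero] at hQ2
    exact hγ (by exact_mod_cast hQ2.symm)
  have hroot : aeval (liouvilleNumber 2) Q = 0 := by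
    rw [hQ]
    simp only [map_add, map_mul, aeval_C, aeval_X, map_pow, eq_ratCast]
    rw [hA, hB]
    push_cast
    linear_combination h
  have halg : IsAlgebraic ℚ (liouvilleNumber 2) := ⟨Q, hQ0, hroot⟩
  have halgZ : IsAlgebraic ℤ (liouvilleNumber 2) := (IsFractionRing.isAlgebraic_iff ℤ ℚ ℝ).mpr halg
  have htr : Transcendental ℤ (liouvilleNumber (2 : ℝ)) := by
    simpa using transcendental_liouvilleNumber (m := 2) le_rfl
  exact htr halgZ

/-- **joint continuity at `(ℓ₂, κ)`**: there are `ρ > 0` and `N₀` such that `P(s_N, y) ≠ 0` for all `N ≥ N₀` and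
all real `y` with `|y − κ| < ρ`. -/
theorem no_point_near (q : SectorBox) (hγ : q.γ ≠ 0) (κ : ℚ) :
    ∃ ρ : ℝ, 0 < ρ ∧ ∃ N₀ : ℕ, ∀ N : ℕ, N₀ ≤ N → ∀ y : ℝ, |y - κ| < ρ →
      bev (boxP q) (partialSum 2 N) y ≠ 0 := by
  have hcont : Continuous (fun u : ℝ × ℝ => bev (boxP q) u.1 u.2) := by
    have hfun : (fun u : ℝ × ℝ => bev (boxP q) u.1 u.2) = fun u : ℝ × ℝ =>
        u.2 ^ 4 + q.δ * u.2 ^ 3 + q.ζ₂ * u.2 ^ 2 + q.ζ₁ * u.2 + q.ζ₀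
          + u.1 * (q.α * u.2 ^ 2 + q.β * u.2 + q.ε) + q.γ * u.1 ^ 2 := by
      funext u
      exact bev_boxP q u.1 u.2
    rw [hfun]
    fun_prop
  have h0 : (fun u : ℝ × ℝ => bev (boxP q) u.1 u.2) (liouvilleNumber 2, (κ : ℝ)) ≠ 0 :=
    bev_boxP_liouville_ne_zero q hγ κ
  have hev : ∀ᶠ u in nhds (liouvilleNumber 2, (κ : ℝ)), (fun u : ℝ × ℝ => bev (boxP q) u.1 u.2) u ≠ 0 :=
    hcont.continuousAt.eventually_ne h0
  obtain ⟨ε₀, hε₀, hball⟩ := Metric.eventually_nhds_iff.mp hev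
  obtain ⟨N₀, hN₀⟩ := (Metric.tendsto_atTop.mp tendsto_partialSum_two) ε₀ hε₀
  refine ⟨ε₀, hε₀, N₀, fun N hN y hy => ?_⟩
  have hd : dist (partialSum 2 N, y) (liouvilleNumber 2, (κ : ℝ)) < ε₀ := by
    rw [Prod.dist_eq]
    refine max_lt (hN₀ N hN) ?_
    rw [Real.dist_eq]
    exact hy
  exact hball hd

/-- `N ≤ 2·2^m` on a level with `2m = N!`. -/
theorem level_le_two_mul_pow (N m : ℕ) (hm : 2 * m = N !) : (N : ℝ) ≤ 2 * (2 : ℝ) ^ m := by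
  have h1 : N ≤ N ! := Nat.self_le_factorial N
  have h2 : m < 2 ^ m := Nat.lt_two_pow_self
  have h3 : (N : ℝ) ≤ 2 * m := by exact_mod_cast (show N ≤ 2 * m by omega)
  have h4 : (m : ℝ) ≤ (2 : ℝ) ^ m := by exact_mod_cast h2.le
  linarith

/-- **FINITELY MANY LEVELS PER RATIONAL SUBSPACE** (no Diophantine input).  For `γ ≠ 0` and non-zero `f ∈ ℚ³` the
levels `N` carrying a point `r` of `boxP q` of level shape (`den r = 2^m`, `2m = N!`) with
`f₀·num r + f₁ + f₂·den r = 0` form a finite set: `f₀ = 0` pins `den r`; `f₀ ≠ 0` makes `r = κ + λ/den r` with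
`κ = −f₂/f₀`, and near `κ` large levels carry no point (`no_point_near`). -/
theorem sector_subspace_levels_finite (q : SectorBox) (hγ : q.γ ≠ 0) (f : Fin 3 → ℚ) (hf : f ≠ 0) :
    {N : ℕ | ∃ r : ℚ, ∃ m : ℕ, 2 * m = N ! ∧ (r.den : ℤ) = 2 ^ m ∧ bev (boxP q) (partialSum 2 N) r = 0 ∧
      f 0 * r.num + f 1 + f 2 * r.den = 0}.Finite := by
  by_cases h0 : f 0 = 0
  · by_cases h2 : f 2 = 0
    · -- `f = (0, f₁, 0)` with `f₁ ≠ 0`: the relation says `f₁ = 0` — no level at all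
      have h1 : f 1 ≠ 0 := by
        intro h1; apply hf; funext j
        fin_cases j
        · exact h0
        · exact h1
        · exact h2
      refine Set.finite_empty.subset ?_
      rintro N ⟨r, m, -, -, -, hrel⟩
      rw [h0, h2, zero_mul, zero_mul, zero_add, add_zero] at hrel
      exact h1 hrel
    · -- `f₀ = 0 ≠ f₂`: `den r = −f₁/f₂` is pinned, and `N ≤ 2·den r`
      obtain ⟨Bn, hBn⟩ := exists_nat_ge (2 * |((f 1 : ℚ) : ℝ) / ((f 2 : ℚ) : ℝ)|)
      refine (Set.finite_le_nat Bn).subset ?_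
      rintro N ⟨r, m, hm, hden, -, hrel⟩
      rw [h0, zero_mul, zero_add] at hrel
      have hf2R : ((f 2 : ℚ) : ℝ) ≠ 0 := by exact_mod_cast h2
      have hdenR : (r.den : ℝ) = (2 : ℝ) ^ m := by
        have h := congrArg (Int.cast : ℤ → ℝ) hden
        push_cast at h
        exact h
      have hrelR : ((f 1 : ℚ) : ℝ) + ((f 2 : ℚ) : ℝ) * (r.den : ℝ) = 0 := by
        have h := congrArg (fun x : ℚ => (x : ℝ)) hrel
        push_cast at h
        exact h
      have hdenq : (r.den : ℝ) = -(((f 1 : ℚ) : ℝ) / ((f 2 : ℚ) : ℝ)) := by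
        field_simp
        linarith
      have hle : (N : ℝ) ≤ Bn := by
        calc (N : ℝ) ≤ 2 * (2 : ℝ) ^ m := level_le_two_mul_pow N m hm
          _ = 2 * |(r.den : ℝ)| := by rw [hdenR, abs_of_pos (by positivity)]
          _ = 2 * |((f 1 : ℚ) : ℝ) / ((f 2 : ℚ) : ℝ)| := by rw [hdenq, abs_neg]
          _ ≤ Bn := hBn
      exact_mod_cast hle
  · -- `f₀ ≠ 0`: `r = κ + λ/den r`, `κ = −f₂/f₀`, `λ = −f₁/f₀`; near `κ` large levels carry no point
    set κ : ℚ := -f 2 / f 0 with hκ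
    set lam : ℚ := -f 1 / f 0 with hlam
    obtain ⟨ρ, hρ, N₀, hN₀⟩ := no_point_near q hγ κ
    have hL : 0 < max 1 |((lam : ℚ) : ℝ)| := by positivity
    obtain ⟨t, ht⟩ := exists_pow_lt_of_lt_one (show 0 < ρ / max 1 |((lam : ℚ) : ℝ)| by positivity)
      (show (1 / 2 : ℝ) < 1 by norm_num)
    refine (Set.finite_le_nat (max N₀ (t + 1))).subset ?_
    rintro N ⟨r, m, hm, hden, hP, hrel⟩
    by_contra hNbig
    simp only [Set.mem_setOf_eq, not_le, max_lt_iff] at hNbig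
    obtain ⟨hNN₀, hNt⟩ := hNbig
    have hN2 : 2 ≤ N := by
      by_contra hlt
      interval_cases N <;> simp at hm
    obtain ⟨-, -, -, hmN⟩ := level_exponents hN2 hm
    have htm : t ≤ m := by omega
    -- `r − κ = λ/den r`
    have hden0 : (r.den : ℚ) ≠ 0 := by exact_mod_cast r.den_nz
    have hnum : (r.num : ℚ) = r * r.den := (Rat.mul_den_eq_num r).symm
    have hr : (r : ℚ) - κ = lam / r.den := by
      rw [hκ, hlam]
      field_simp
      rw [hnum] at hrel
      linear_combination hrel
    have hdenR : (r.den : ℝ) = (2 : ℝ) ^ m := by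
      have h := congrArg (Int.cast : ℤ → ℝ) hden
      push_cast at h
      exact h
    have hdist : |(r : ℝ) - κ| < ρ := by
      have h := congrArg (fun x : ℚ => (x : ℝ)) hr
      push_cast at h
      rw [h, hdenR, abs_div, abs_of_pos (by positivity : (0 : ℝ) < 2 ^ m), div_eq_mul_inv, ← inv_pow,
        ← one_div]
      calc |((lam : ℚ) : ℝ)| * (1 / 2 : ℝ) ^ m ≤ max 1 |((lam : ℚ) : ℝ)| * (1 / 2 : ℝ) ^ t :=
            mul_le_mul (le_max_right _ _) (pow_le_pow_of_le_one (by norm_num) (by norm_num) htm)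
              (by positivity) hL.le
        _ < max 1 |((lam : ℚ) : ℝ)| * (ρ / max 1 |((lam : ℚ) : ℝ)|) := mul_lt_mul_of_pos_left ht hL
        _ = ρ := by field_simp
    exact hN₀ N hNN₀.le (r : ℝ) hdist hP

/-! ### §6  Assembly: WINDOW LEVEL-FINITENESS of the box, modulo `PadicSubspace` -/

/-- `|num r| = |r| · den r` — PORT NOTE (census-1 g25): a PRIVATE copy of K's `abs_num_eq` (l.607, privatised in part 02
after the `dedup.landed` bounce p850098 against the tree's `RootDecomp1EPointTransfer.abs_num_eq`) for its one use below; same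
statement and proof as K; private names do not cross part boundaries. -/
private theorem abs_num_eq (r : ℚ) : |(r.num : ℝ)| = |(r : ℝ)| * r.den := by
  have h := Rat.mul_den_eq_num r
  have h' : ((r * (r.den : ℚ) : ℚ) : ℝ) = ((r.num : ℚ) : ℝ) := by rw [h]
  push_cast at h'
  rw [← h', abs_mul, abs_of_nonneg (by positivity : (0 : ℝ) ≤ (r.den : ℝ))]

/-- **THE SECTOR IS SUBSPACE — WINDOW LEVEL-FINITENESS, MODULO `PadicSubspace`.**  For every member `q` of the
dominant `(4,2)`-box with `γ` odd and separable edge quartic `W⁴ + αW² + γ`, and every window `|r| ≤ C`: beyond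
some level `N₀ = N₀(q, C)` NO rational `r` with `|r| ≤ C` lies on a level curve `P(s_N, ·) = 0`.  Near each simple
edge root `ξ ∈ ℂ₂` the integer vector `(num r, 1, den r)` of a level point satisfies Schlickewei's inequality
(`q = 2`) for the forms `Lform`, `Mform ξ γ_ξ` (§2–§4), hence lies in one of finitely many rational subspaces, each
carrying finitely many levels (§5). -/
theorem window_levels_finite (hS : PadicSubspace) (q : SectorBox) (hγ : Odd q.γ)
    (hsep : ((edgeF q).map (Int.castRingHom ℚ)).Separable) (C : ℝ) :
    ∃ N₀ : ℕ, ∀ N : ℕ, N₀ ≤ N → ∀ r : ℚ, |(r : ℝ)| ≤ C → bev (boxP q) (partialSum 2 N) r ≠ 0 := by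
  classical
  have hγ0 : q.γ ≠ 0 := fun h => by have := Int.odd_iff.mp hγ; omega
  obtain ⟨T, c₀, hc₀, -, hTroots, -, hnear⟩ :=
    nearest_root (edgeF q) (by rw [natDegree_edgeF]; norm_num) hsep
  set K₀ : ℝ := max 1 c₀ with hK₀
  have hK₀1 : 1 ≤ K₀ := le_max_left _ _
  have hder : ∀ ξ ∈ T, aeval ξ (derivative (edgeF q)) ≠ 0 := fun ξ hξ =>
    aeval_derivative_ne_zero_of_sep (edgeF q) hsep (hTroots ξ hξ)
  -- (§2) the second-order constant at each root
  have hK : ∀ ξ ∈ T, ∃ K : ℝ, 0 < K ∧ ∀ N m : ℕ, 2 ≤ N → 2 * m = N ! → ∀ a : ℤ, redLHS q N m a = 0 →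
      ‖(a : PadicAlgCl 2) - ξ‖ ≤ K₀ * (1 / 2 : ℝ) ^ m → ‖(a : PadicAlgCl 2) - ξ‖ ≤ 1 →
      ‖((a : PadicAlgCl 2) - ξ) + (2 : PadicAlgCl 2) ^ m * (aeval ξ (subG q) / aeval ξ (derivative (edgeF q)))‖ ≤
        K * (1 / 2 : ℝ) ^ ((N !) - (N - 1)!) :=
    fun ξ hξ => second_order q (hTroots ξ hξ) (hder ξ hξ) K₀ hK₀1
  choose! Kf hKpos hKf using hK
  -- (§0) Schlickewei at each root with `q = 2`: finitely many rational subspaces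
  have hT : ∀ ξ ∈ T, ∃ Tξ : Finset (Fin 3 → ℚ), (∀ f ∈ Tξ, f ≠ 0) ∧ ∀ x : Fin 3 → ℤ, x ≠ 0 →
      ((∏ i, |∑ j, Lform i j * (x j : ℝ)|) *
          (∏ i, ‖∑ j, Mform ξ (aeval ξ (subG q) / aeval ξ (derivative (edgeF q))) i j * (x j : PadicAlgCl 2)‖)) ^ 2 *
        ((Finset.univ.sup fun j => (x j).natAbs : ℕ) : ℝ) < 1 →
      ∃ f ∈ Tξ, ∑ j, f j * (x j : ℚ) = 0 := by
    intro ξ hξ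
    have halg := isAlgebraic_of_aeval_eq_zero (edgeF_ne_zero q) (hTroots ξ hξ)
    have halgγ := isAlgebraic_corr (subG q) (edgeF q) (edgeF_ne_zero q) (hTroots ξ hξ)
    exact hS 3 (by norm_num) 2 Lform (Mform ξ _) Lform_isAlgebraic (Mform_isAlgebraic halg halgγ)
      Lform_linearIndependent (Mform_linearIndependent _ _) 2 (by norm_num)
  choose! Tf hTf0 hTf using hT
  -- (§5) the bad levels: finitely many
  have hbad : (⋃ ξ ∈ (T : Set (PadicAlgCl 2)), ⋃ f ∈ (Tf ξ : Set (Fin 3 → ℚ)),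
      {N : ℕ | ∃ r : ℚ, ∃ m : ℕ, 2 * m = N ! ∧ (r.den : ℤ) = 2 ^ m ∧ bev (boxP q) (partialSum 2 N) r = 0 ∧
        f 0 * r.num + f 1 + f 2 * r.den = 0}).Finite := by
    refine T.finite_toSet.biUnion fun ξ hξ => (Tf ξ).finite_toSet.biUnion fun f hf => ?_
    exact sector_subspace_levels_finite q hγ0 f (hTf0 ξ hξ f hf)
  obtain ⟨N₃, hN₃⟩ := hbad.bddAbove
  -- uniform constants and the exponent inequality (§4)
  set Kmax : ℝ := ∑ ξ ∈ T, Kf ξ with hKmax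
  have hKle : ∀ ξ ∈ T, Kf ξ ≤ Kmax := fun ξ hξ =>
    Finset.single_le_sum (fun b hb => (hKpos b hb).le) hξ
  have hKmax0 : 0 ≤ Kmax := Finset.sum_nonneg fun b hb => (hKpos b hb).le
  obtain ⟨N₂, hN₂⟩ := sector_arith ((max 1 C * Kmax) ^ 2 * (3 * max 1 C))
  obtain ⟨N₅, hN₅⟩ := eventually_K₀_small_ss K₀ hK₀1
  refine ⟨max (max 2 N₂) (max (N₃ + 1) N₅), fun N hN r hr hP => ?_⟩
  simp only [max_le_iff] at hN
  obtain ⟨⟨hN2, hNN₂⟩, hNN₃, hNN₅⟩ := hN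
  obtain ⟨m, hm⟩ : ∃ m, 2 * m = N ! := by
    obtain ⟨m, hm⟩ := Nat.dvd_factorial (by norm_num : 0 < 2) hN2
    exact ⟨m, hm.symm⟩
  obtain ⟨hden, -, hred⟩ := level_shape q hγ hN2 hm hP
  -- (§2) first order: `num r` is near a simple edge root `ξ`
  have hf1 := first_order q hN2 hm hred
  obtain ⟨ξ, hξT, hξ⟩ := hnear (r.num : PadicAlgCl 2)
  have hδ : ‖(r.num : PadicAlgCl 2) - ξ‖ ≤ K₀ * (1 / 2 : ℝ) ^ m := by
    calc ‖(r.num : PadicAlgCl 2) - ξ‖ ≤ c₀ * ‖aeval (r.num : PadicAlgCl 2) (edgeF q)‖ := hξ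
      _ ≤ c₀ * (1 / 2 : ℝ) ^ m := by gcongr
      _ ≤ K₀ * (1 / 2 : ℝ) ^ m := by gcongr; exact le_max_right _ _
  have hδ1 : ‖(r.num : PadicAlgCl 2) - ξ‖ ≤ 1 := hδ.trans (hN₅ N m hNN₅ hm)
  -- (§2) second order
  have happrox := hKf ξ hξT N m hN2 hm r.num hred hδ hδ1
  set γ₁ : PadicAlgCl 2 := aeval ξ (subG q) / aeval ξ (derivative (edgeF q)) with hγ₁
  set η : ℝ := (1 / 2 : ℝ) ^ ((N !) - (N - 1)!) with hη
  have hη0 : 0 ≤ η := by positivity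
  -- sizes
  have hdenR : (r.den : ℝ) = (2 : ℝ) ^ m := by
    have h := congrArg (Int.cast : ℤ → ℝ) hden
    push_cast at h
    exact h
  have hdenC : (r.den : PadicAlgCl 2) = (2 : PadicAlgCl 2) ^ m := by
    have h := congrArg (Int.cast : ℤ → PadicAlgCl 2) hden
    push_cast at h
    exact h
  have hC1 : 1 ≤ max 1 C := le_max_left _ _
  -- (§3) the real side `≤ max(1,C)·den²`
  have hreal : |(r.num : ℝ)| * (r.den : ℝ) ≤ max 1 C * (r.den : ℝ) ^ 2 := by
    rw [abs_num_eq]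
    calc |(r : ℝ)| * r.den * r.den ≤ max 1 C * r.den * r.den := by
          gcongr; exact hr.trans (le_max_right _ _)
      _ = max 1 C * (r.den : ℝ) ^ 2 := by ring
  -- (§3) the 2-adic side `≤ Kmax·η·2^{−m}`
  have hpadic : ‖((r.num : PadicAlgCl 2) - ξ) + (r.den : PadicAlgCl 2) * γ₁‖ * ‖(r.den : PadicAlgCl 2)‖ ≤
      Kmax * η * (1 / 2 : ℝ) ^ m := by
    rw [hdenC, norm_two_pow_ss]
    have h1 : ‖((r.num : PadicAlgCl 2) - ξ) + (2 : PadicAlgCl 2) ^ m * γ₁‖ ≤ Kmax * η :=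
      happrox.trans (mul_le_mul_of_nonneg_right (hKle ξ hξT) hη0)
    exact mul_le_mul_of_nonneg_right h1 (by positivity)
  have hsup := svec_sup_le r C hr
  have harith := hN₂ N m hNN₂ hm
  -- (§4) Schlickewei's inequality holds at this point
  have hineq : ((∏ i, |∑ j, Lform i j * ((svec r j : ℤ) : ℝ)|) *
        (∏ i, ‖∑ j, Mform ξ γ₁ i j * ((svec r j : ℤ) : PadicAlgCl 2)‖)) ^ 2 *
      ((Finset.univ.sup fun j => (svec r j).natAbs : ℕ) : ℝ) < 1 := by
    rw [Lform_prod_svec, Mform_prod_svec]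
    have hnn1 : 0 ≤ |(r.num : ℝ)| * (r.den : ℝ) := by positivity
    have hnn2 : 0 ≤ ‖((r.num : PadicAlgCl 2) - ξ) + (r.den : PadicAlgCl 2) * γ₁‖ * ‖(r.den : PadicAlgCl 2)‖ := by
      positivity
    calc (|(r.num : ℝ)| * (r.den : ℝ) *
            (‖((r.num : PadicAlgCl 2) - ξ) + (r.den : PadicAlgCl 2) * γ₁‖ * ‖(r.den : PadicAlgCl 2)‖)) ^ 2 *
          ((Finset.univ.sup fun j => (svec r j).natAbs : ℕ) : ℝ)
        ≤ ((max 1 C * (r.den : ℝ) ^ 2) * (Kmax * η * (1 / 2 : ℝ) ^ m)) ^ 2 * (3 * max 1 C * (r.den : ℝ)) := by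
          refine mul_le_mul (pow_le_pow_left₀ (mul_nonneg hnn1 hnn2)
            (mul_le_mul hreal hpadic hnn2 (by positivity)) 2) hsup (by positivity) (by positivity)
      _ = (max 1 C * Kmax) ^ 2 * (3 * max 1 C) * ((2 : ℝ) ^ m) ^ 3 * η ^ 2
            * ((2 : ℝ) ^ m * (1 / 2 : ℝ) ^ m) ^ 2 := by
          rw [hdenR]; ring
      _ = (max 1 C * Kmax) ^ 2 * (3 * max 1 C) * ((2 : ℝ) ^ m) ^ 3 * η ^ 2 := by
          rw [two_pow_mul_half_pow_ss, one_pow, mul_one]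
      _ < 1 := harith
  obtain ⟨f, hfT, hrel⟩ := hTf ξ hξT (svec r) (svec_ne_zero r) hineq
  rw [svec_relation] at hrel
  have hmem : N ∈ ⋃ ξ ∈ (T : Set (PadicAlgCl 2)), ⋃ f ∈ (Tf ξ : Set (Fin 3 → ℚ)),
      {N : ℕ | ∃ r : ℚ, ∃ m : ℕ, 2 * m = N ! ∧ (r.den : ℤ) = 2 ^ m ∧ bev (boxP q) (partialSum 2 N) r = 0 ∧
        f 0 * r.num + f 1 + f 2 * r.den = 0} :=
    Set.mem_biUnion (Finset.mem_coe.mpr hξT) (Set.mem_biUnion (Finset.mem_coe.mpr hfT) ⟨r, m, hm, hden, hP, hrel⟩)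
  have := hN₃ hmem
  omega

/-- **HEADLINE — the thin-fibre clause at EVERY quality `m₀` for the simple-edge box, modulo `PadicSubspace`**
(vacuously: large levels carry no window point at all). -/
theorem thinFibreAt_box_of_padicSubspace (hS : PadicSubspace) (q : SectorBox) (hγ : Odd q.γ)
    (hsep : ((edgeF q).map (Int.castRingHom ℚ)).Separable) (m₀ : ℕ) : ThinFibreAt m₀ (boxP q) := by
  intro C
  obtain ⟨N₀, h⟩ := window_levels_finite hS q hγ hsep C
  exact ⟨N₀, fun N hN r hr hP _ => absurd hP (h N hN r hr)⟩

/-- **`LevelFinite (boxP q)` MODULO `PadicSubspace`** — the record's residual class statement (tree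
`RootDecomp1KLevelFinite.LevelFinite`: every level set `LevelSet P C` is finite).  Window level-finiteness is the
clause-free form: `LevelSet (boxP q) C ⊆ {N | N < N₀}`. -/
theorem levelSet_box_subset_of_padicSubspace (hS : PadicSubspace) (q : SectorBox) (hγ : Odd q.γ)
    (hsep : ((edgeF q).map (Int.castRingHom ℚ)).Separable) (C : ℝ) :
    ∃ N₀ : ℕ, LevelSet (boxP q) C ⊆ {N | N < N₀} := by
  obtain ⟨N₀, h⟩ := window_levels_finite hS q hγ hsep C
  refine ⟨N₀, fun N hN => ?_⟩
  obtain ⟨r, hr, hP, -⟩ := hN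
  by_contra hlt
  simp only [Set.mem_setOf_eq, not_lt] at hlt
  exact h N hlt r hr hP

/-- **`LevelFinite (boxP q)` MODULO `PadicSubspace`.** -/
theorem levelFinite_box_of_padicSubspace (hS : PadicSubspace) (q : SectorBox) (hγ : Odd q.γ)
    (hsep : ((edgeF q).map (Int.castRingHom ℚ)).Separable) : LevelFinite (boxP q) := by
  intro C
  obtain ⟨N₀, h⟩ := levelSet_box_subset_of_padicSubspace hS q hγ hsep C
  exact (Set.finite_lt_nat N₀).subset h

/-- `BddLevelEmpty (boxP q)` (node 12's (b)) MODULO `PadicSubspace` — by the tree's `bddLevelEmpty_iff_levelFinite`. -/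
theorem bddLevelEmpty_box_of_padicSubspace (hS : PadicSubspace) (q : SectorBox) (hγ : Odd q.γ)
    (hsep : ((edgeF q).map (Int.castRingHom ℚ)).Separable) : BddLevelEmpty (boxP q) :=
  (bddLevelEmpty_iff_levelFinite _).mpr (levelFinite_box_of_padicSubspace hS q hγ hsep)

/-- the thin-fibre clause again, through the tree's door `thinFibreAt_of_levelFinite` (same statement as
`thinFibreAt_box_of_padicSubspace`). -/
theorem thinFibreAt_box_of_padicSubspace' (hS : PadicSubspace) (q : SectorBox) (hγ : Odd q.γ)
    (hsep : ((edgeF q).map (Int.castRingHom ℚ)).Separable) (m₀ : ℕ) : ThinFibreAt m₀ (boxP q) :=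
  thinFibreAt_of_levelFinite (levelFinite_box_of_padicSubspace hS q hγ hsep) m₀

end Summit.Schanuel.Schanuel.Theorems.RootDecomp1KSectorSubspace
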